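import Summits.SmoothPoincare4.SmoothPoincare4.Theorems.ConvexBisectionAcyclicBisectionRigidityCancelPairClosed
import Summits.SmoothPoincare4.SmoothPoincare4.Theorems.ConvexBisectionAcyclicBisectionRigidityStubPropertyRClosing
import Literature.Topology.FourManifolds.ClosedAsCobordism
import Literature.Topology.FourManifolds.MorseCountPalindrome
import Literature.Topology.FourManifolds.CerfGammaFour
import Literature.Topology.FourManifolds.HomotopyS4CompactProofs
import HarnessLib

/-!
# Calibration of the duality lever: unrestricted index-`1` duality + Cerf ⇒ every Morse-presented homotopy `4`-sphere is `S⁴`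

Helper file (crux `ConvexBisection.AcyclicBisectionRigidity`, item stmt-SmoothPoincare4-10507,
line `seam-duality-cancellation`; re-land of lead c1's lost `DualityIterate`).  The conjectural
step of the line is a GEOMETRIC DUALITY claim: some `1`-handle/`2`-handle pair of a Morse
presentation of the homotopy sphere can be put in Milnor's cancelling position (Def. 5.1: in the
intermediate level `V_{1+}` the right-hand sphere of the index-`1` point and the left-hand sphere
of the index-`2` point meet in ONE point, transversely).  This file is the CALIBRATION showing
that the UNRESTRICTED form `hD` of that claim ("on any homotopy `4`-sphere, any nice Morse
function with a critical point of index `1` can be replaced by one with the same numbers of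
critical points of each index having such a transverse single-intersection `(1, 2)` pair") is
already SPC4-complete given Cerf's `Γ₄ = 0`:

* `nonempty_diffeomorph_sphere_of_isMorse_of_duality` — `hD` + Cerf ⇒ every homotopy `4`-sphere
  `X` carrying a Morse function is diffeomorphic to `S⁴`.  PROOF.  ITERATE (the step `key` of
  the proof): by induction on `c₁ = #Crit₁`, a Morse function `G` on `X` is traded for one
  without critical points of index `1` and with `#Crit₂ - c₁` critical points of index `2` —
  rescale `G` into `(0, 1)` and rearrange it into a NICE Morse function `g` on the cobordism
  `(X; ∅, ∅) = Cobordism.ofClosed 3 X` with the same counts (Milnor 1965, Def. 3.1 and Thm. 4.8: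
  `exists_isNiceMorseFunction_ofClosed_ncard_eq`, from `IsMorse.exists_isMorseFunction_ofClosed`
  and `Cobordism.Milnor1965_finalRearrangement_holds`), let `hD` supply `g'` (same counts) with a
  cancellable `(1, 2)` pair, cancel it (Milnor's Thm. 5.4 on a closed manifold, the tree's
  `Cancellation.exists_isMorse_of_cancelPair`: `c₁` and `c₂` drop by one, the other counts are
  kept), and recurse.  Then: a first pass kills the index-`1` points of `F`; the normal form
  `ExchangeRecognition.exists_isMorse_normalForm` (one minimum, `χ = 2`, turning about) yields a
  Morse function of profile `(1, c, c, 0, 1)`; a second pass on it ends with NO critical point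
  of index `1` and `c - c = 0` of index `2`; `ExchangeRecognition.stub_propertyRClosing_noTwoHandle`
  (two critical points after normalisation: a twisted sphere, `≅ S⁴` by Cerf) concludes.

Everything is proved; no definitions, no named facts besides the hypothesis `hC` (Cerf).

## References

* J. Milnor, *Lectures on the h-cobordism theorem*, Princeton (1965), Def. 3.1, Thm. 4.8
  (PDF p. 25), Def. 5.1 and Thm. 5.4 (PDF p. 27), §1 (closed manifolds as triads `(W; ∅, ∅)`).
  [MilnorHCobordism1965]
* J. Milnor, *Morse theory*, Ann. of Math. Studies 51 (1963), §2, Thm. 4.1. [Milnor1963]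
* J. Cerf, *Sur les difféomorphismes de la sphère de dimension trois (Γ₄ = 0)*, LNM 53 (1968).
  [CerfDiffeoSphere1968]
-/

open scoped Manifold ContDiff Topology ContinuousMap
open Set Function Filter

noncomputable section

-- the prescribed namespace `Summit.<P>.<Sub>.…` duplicates `SmoothPoincare4` (P = Sub)
set_option linter.dupNamespace false

namespace Summit.SmoothPoincare4.SmoothPoincare4.Theorems.AcyclicBisectionRigidity.Cancellation

open Literature.Topology.FourManifolds Literature.Topology.FourManifolds.Cobordism
open Summit.SmoothPoincare4.SmoothPoincare4.Theorems.AcyclicBisectionRigidity.ExchangeRecognition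

section Calibration

variable {X : Type} [TopologicalSpace X] [T2Space X] [SecondCountableTopology X]
  [CompactSpace X] [ChartedSpace (EuclideanSpace ℝ (Fin 4)) X] [IsManifold (𝓡 4) ∞ X]

/-- **A Morse function on a closed `4`-manifold, made nice on the cobordism `(X; ∅, ∅)`**
(Milnor 1965, Def. 3.1 and Thm. 4.8, alternate version): for every Morse function `F` on a
nonempty closed `4`-manifold `X` there is a nice Morse function on `Cobordism.ofClosed 3 X` with
as many critical points of each index — rescale `F` into `(0, 1)`
(`IsMorse.exists_isMorseFunction_ofClosed`) and rearrange (`Cobordism.Milnor1965_finalRearrangement_holds`,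
same critical points and indices). [cite: MilnorHCobordism1965, Def. 3.1 (PDF p. 11), Thm. 4.8 (PDF p. 25)] -/
theorem exists_isNiceMorseFunction_ofClosed_ncard_eq [Nonempty X] {F : X → ℝ}
    (hF : IsMorse (𝓡 4) F) :
    ∃ g : (Cobordism.ofClosed 3 X).W → ℝ, (Cobordism.ofClosed 3 X).IsNiceMorseFunction g ∧
      ∀ k, (criticalSetOfIndex (𝓡∂ 4) g k).ncard = (criticalSetOfIndex (𝓡 4) F k).ncard := by
  obtain ⟨A, B, -, hf, hcount⟩ := hF.exists_isMorseFunction_ofClosed (n := 3)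
  obtain ⟨g, hg, hcrit, hind⟩ := Cobordism.Milnor1965_finalRearrangement_holds hf
  exact ⟨g, hg, fun k => (ncard_criticalSetOfIndex_congr hcrit hind k).trans (hcount k)⟩

end Calibration

/-- **Calibration: unrestricted index-`1` geometric duality + Cerf ⇒ every Morse-presented
homotopy `4`-sphere is `S⁴`.**  Assume Cerf's `Γ₄ = 0` (`hC`) and the unrestricted duality `hD`:
on every homotopy `4`-sphere `X`, every nice Morse function on `(X; ∅, ∅)` with a critical point
of index `1` can be replaced by a nice Morse function with the same numbers of critical points
of each index, admitting a gradient-like field for which some index-`1` point `p` and index-`2`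
point `q` have `S_R(p) ∩ S_L(q) = {x₀}` transversely in the level `V_{1+} = g'⁻¹(plusLevel 3 1)`
(Milnor 1965, Def. 5.1).  Then every homotopy `4`-sphere carrying a Morse function is
diffeomorphic to `S⁴`: cancel all index-`1` points pair by pair (Thm. 5.4 on the closed
manifold, `exists_isMorse_of_cancelPair`, iterated by induction on `#Crit₁`: the step `key`),
normalise to the profile `(1, c, c, 0, 1)` (`exists_isMorse_normalForm`), cancel again down to
`(1, 0, 0, 0, 1)`, and conclude by Reeb–Milnor–Cerf (`stub_propertyRClosing_noTwoHandle`).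
[cite: MilnorHCobordism1965, Def. 5.1 and Thm. 5.4 (PDF p. 27), Thm. 4.8 (PDF p. 25)]
[cite: Milnor1963, Thm. 4.1 and Remark (p. 25)] [cite: CerfDiffeoSphere1968, Γ₄ = 0] -/
theorem nonempty_diffeomorph_sphere_of_isMorse_of_duality (hC : cerf_twistedSphere_four)
    (hD : ∀ (X : Type) [TopologicalSpace X] [T2Space X] [SecondCountableTopology X]
      [CompactSpace X] [ChartedSpace (EuclideanSpace ℝ (Fin 4)) X] [IsManifold (𝓡 4) ∞ X],
      X ≃ₕ (Metric.sphere (0 : EuclideanSpace ℝ (Fin 5)) 1) →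
      ∀ g : (Cobordism.ofClosed 3 X).W → ℝ, (Cobordism.ofClosed 3 X).IsNiceMorseFunction g →
      (criticalSetOfIndex (𝓡∂ 4) g 1).ncard ≠ 0 →
      ∃ g' : (Cobordism.ofClosed 3 X).W → ℝ, (Cobordism.ofClosed 3 X).IsNiceMorseFunction g' ∧
        (∀ i, (criticalSetOfIndex (𝓡∂ 4) g' i).ncard = (criticalSetOfIndex (𝓡∂ 4) g i).ncard) ∧
        ∃ (ξ : Cₛ^∞⟮𝓡∂ 4; EuclideanSpace ℝ (Fin 4),
            (TangentSpace (𝓡∂ 4) : (Cobordism.ofClosed 3 X).W → Type)⟯)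
          (_ : IsGradientLike (𝓡∂ 4) g' ξ) (p q x₀ : (Cobordism.ofClosed 3 X).W),
          p ∈ criticalSetOfIndex (𝓡∂ 4) g' 1 ∧ q ∈ criticalSetOfIndex (𝓡∂ 4) g' 2 ∧
          rightHandSphere (𝓡∂ 4) g' ξ p (plusLevel 3 1) ∩
              leftHandSphere (𝓡∂ 4) g' ξ q (plusLevel 3 1) = {x₀} ∧
          IsTransverseInLevel (𝓡∂ 4) (g' ⁻¹' {plusLevel 3 1})
            (rightHandSphere (𝓡∂ 4) g' ξ p (plusLevel 3 1))
            (leftHandSphere (𝓡∂ 4) g' ξ q (plusLevel 3 1)) x₀)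
    (X : Type) [TopologicalSpace X] [T2Space X] [SecondCountableTopology X] [CompactSpace X]
    [ChartedSpace (EuclideanSpace ℝ (Fin 4)) X] [IsManifold (𝓡 4) ∞ X]
    (hX : X ≃ₕ (Metric.sphere (0 : EuclideanSpace ℝ (Fin 5)) 1)) (F : X → ℝ)
    (hF : IsMorse (𝓡 4) F) :
    Nonempty (X ≃ₘ⟮𝓡 4, 𝓡 4⟯ Metric.sphere (0 : EuclideanSpace ℝ (Fin 5)) 1) := by
  -- `X` is path connected, in particular nonempty, being homotopy equivalent to `S⁴`
  haveI : PathConnectedSpace (Metric.sphere (0 : EuclideanSpace ℝ (Fin 5)) 1) :=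
    pathConnectedSpace_sphere_four
  haveI : PathConnectedSpace X :=
    Literature.Topology.FourManifolds.pathConnectedSpace_of_homotopyEquiv hX
  -- the critical sets of Morse functions on the compact `X` are finite
  have hfin : ∀ {G : X → ℝ}, IsMorse (𝓡 4) G → ∀ k, (criticalSetOfIndex (𝓡 4) G k).Finite :=
    fun hG k => (IsMorse.finite_criticalSet_holds hG).subset (criticalSetOfIndex_subset _ _ k)
  -- ITERATE: cancel all the critical points of index `1`, one `(1, 2)` pair at a time
  -- (induction on `c₁`; each round: nicefy, `hD`, Milnor's Thm. 5.4 on the closed manifold)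
  have key : ∀ (m : ℕ) (G : X → ℝ), IsMorse (𝓡 4) G →
      (criticalSetOfIndex (𝓡 4) G 1).ncard = m →
      ∃ G' : X → ℝ, IsMorse (𝓡 4) G' ∧ (criticalSetOfIndex (𝓡 4) G' 1).ncard = 0 ∧
        (criticalSetOfIndex (𝓡 4) G' 2).ncard + m = (criticalSetOfIndex (𝓡 4) G 2).ncard := by
    intro m
    induction m with
    | zero => exact fun G hG h1 => ⟨G, hG, h1, rfl⟩
    | succ m ih =>
      intro G hG h1
      -- a nice Morse function on `(X; ∅, ∅)` with the counts of `G`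
      obtain ⟨g, hg, hcount⟩ := exists_isNiceMorseFunction_ofClosed_ncard_eq hG
      -- duality: same counts, and a `(1, 2)` pair in cancelling position
      obtain ⟨g', hg', hcount', ξ, hξ, p, q, x₀, hp, hq, hx₀, htr⟩ :=
        hD X hX g hg (by rw [hcount 1, h1]; exact Nat.succ_ne_zero m)
      -- Milnor's First Cancellation Theorem on the closed manifold
      obtain ⟨G'', hG'', h1'', h2'', -⟩ :=
        exists_isMorse_of_cancelPair (n := 3) (k := 1) hg' ξ hξ hp hq hx₀ htr
      have e1 : (criticalSetOfIndex (𝓡 4) G'' 1).ncard + 1 =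
          (criticalSetOfIndex (𝓡∂ 4) g' 1).ncard := h1''
      have e2 : (criticalSetOfIndex (𝓡 4) G'' 2).ncard + 1 =
          (criticalSetOfIndex (𝓡∂ 4) g' 2).ncard := h2''
      have c1 := hcount' 1
      have c2 := hcount' 2
      have d1 := hcount 1
      have d2 := hcount 2
      -- recurse
      obtain ⟨G', hG', hG'1, hG'2⟩ := ih G'' hG'' (by omega)
      exact ⟨G', hG', hG'1, by omega⟩
  -- first pass: no critical point of index `1`
  obtain ⟨F₁, hF₁, hF₁1, -⟩ := key _ F hF rfl
  have h1 : criticalSetOfIndex (𝓡 4) F₁ 1 = ∅ := (Set.ncard_eq_zero (hfin hF₁ 1)).1 hF₁1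
  -- normal form `(1, c, c, 0, 1)`
  obtain ⟨G, hG, -, hG1, hG2, -, -⟩ := exists_isMorse_normalForm X hX F₁ hF₁ h1
  -- second pass: no critical point of index `1`, and `c - c = 0` of index `2`
  obtain ⟨F₂, hF₂, hF₂1, hF₂2⟩ := key _ G hG rfl
  have h1' : criticalSetOfIndex (𝓡 4) F₂ 1 = ∅ := (Set.ncard_eq_zero (hfin hF₂ 1)).1 hF₂1
  have h2' : criticalSetOfIndex (𝓡 4) F₂ 2 = ∅ := by
    refine (Set.ncard_eq_zero (hfin hF₂ 2)).1 ?_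
    rw [hG1, hG2] at hF₂2
    omega
  -- two critical points after normalisation: a twisted sphere, `≅ S⁴` by Cerf
  exact stub_propertyRClosing_noTwoHandle hC X hX F₂ hF₂ h1' h2'

end Summit.SmoothPoincare4.SmoothPoincare4.Theorems.AcyclicBisectionRigidity.Cancellation

end
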